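/-
Copyright (c) 2026 the pub-hodgecm-mathlib formalisation cell (harness21).  Prover seat hodgecm-mathlib-LH4-p10 (g6): Track A «(D-RAM) FOUR-FRAME» squad of crux H413, (β) TABLE —
sub-dealer LH4-p05 (g8) β-BOARD LEDGER #12 «LH4-p10 → `harith`»; assembler F0P3a-p01 (g37) (socket ★ `sum_box_restShape_eq_of_rows`, dispatcher ★ `restValue_G1_of_rows`).  2026-09-04.
-/
import Mathlib.Algebra.BigOperators.Intervals
import Mathlib.Algebra.Order.BigOperators.Group.Finset
import Mathlib.Tactic
import HarnessLib

/-!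
# Crux `H413`, line LH4 «(D-RAM) FOUR-FRAME» — (β) TABLE, `harith` STEP 1: THE REST DOUBLE SUMS COLLAPSE TO ONE HANGING POINT AND ONE FOOT LINE PER TOWER

Cell `hodgecm-mathlib` (D-0151), FLOOR 0, crux item H413 = `stmt-HodgeConjecture-24833`, route `HCCMUnconditional`; squad F0∕P3c∕LH4.  THEOREMS ONLY (pure `Finset` ∕ `ℚ`
bookkeeping over an arbitrary commutative target is not needed — `ℚ`); lane `--supports stmt-HodgeConjecture-24833 --as helper` (count-neutral).

WHAT.  The `harith` hypothesis of F0P3a-p01 (g37)'s ★ socket `…OddLabelledRestReindex.sum_box_restShape_eq_of_rows` is a pure identity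
`Σ_{ρ ∈ Icc 1 (B∕2)} VH ρ + Σ_ρ Σ_{s ∈ Icc 1 (B − 2ρ)} Σ_k [rest_k(ρ,s)]·VG k ρ s = restTarget`, where the row files deliver the rest values in DIRAC-IN-ρ shape: the hanging row
`VH ρ` vanishes off ONE depth `2ρ + ℓ₀ = m` (R8, LH7-p08∕p09), and the tower-`k` dispatcher (★ `restValue_G1_of_rows` and its twins) gives `VG k ρ s = if 2ρ + ℓ₀ = c_k ∧ (foot
side condition in s) then κ_k ρ s else 0` (R6's κ-classes on the foot depth `c_k`, everything else `0`).  This file does the ρ-collapse ONCE, generically: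
* `sum_Icc_eq_ite_of_vanish_off` — a function on `Icc 1 R` vanishing off `2ρ + l = m` sums to `[l + 2 ≤ m ≤ 2R + l ∧ 2 ∣ m − l] · f ((m − l)∕2)`;
* `sum_sum_ite_dirac_rho` — the double sum `Σ_ρ Σ_{s ∈ Icc 1 (S ρ)} (if Q ρ s then (if 2ρ + l = c ∧ T s then κ ρ s else 0) else 0)` collapses to the single foot line
  `[l + 2 ≤ c ≤ 2R + l ∧ 2 ∣ c − l] · Σ_{s ∈ Icc 1 (S ρ⋆)} (if Q ρ⋆ s ∧ T s then κ ρ⋆ s else 0)`, `ρ⋆ = (c − l)∕2`.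
So `harith` = these two lemmas + the per-tower foot-line totals (R6's closed form, cdis1's unified κ-class rule ∕ its q-exponent fork — NOT decided here) + `restTarget`'s three
`if`s.
HONEST LABEL.  Count-neutral bookkeeping; `harith`, hRest, (β) OPEN; `HC_CM` is proved only modulo the 7 printed citations (2 remaining named inputs: hLiu418 =
`stmt-HodgeConjecture-24832`, h413 = `stmt-HodgeConjecture-24833`) until rung 0 closes.

## References
* [Kottwitz1986BaseChangeUnits] R. E. Kottwitz, *Base change for unit elements of Hecke algebras*, Compositio Math. 60 (1986), §1 pp. 240–241.
* [Rogawski1990] J. D. Rogawski, *Automorphic Representations of Unitary Groups in Three Variables*, Ann. of Math. Stud. 123 (1990), §4.9 Prop. 4.9.1 (a)(b) p. 55.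
-/

set_option autoImplicit false

namespace Summit.HodgeConjecture.HodgeConjecture.Cruxes.H413.F0P3cDyRamOddLabelledRestLines

open Finset

/-- **DIRAC IN `ρ`**: a function on `Icc 1 R` vanishing off the depth `2ρ + l = m` sums to its value at `ρ⋆ = (m − l)∕2` when that point is in range (`l + 2 ≤ m ≤ 2R + l`,
`2 ∣ m − l`), else to `0`. [cite: Kottwitz1986BaseChangeUnits, §1 pp. 240–241] -/
theorem sum_Icc_eq_ite_of_vanish_off (R l m : ℕ) (f : ℕ → ℚ) (h : ∀ ρ, 1 ≤ ρ → ρ ≤ R → 2 * ρ + l ≠ m → f ρ = 0) :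
    ∑ ρ ∈ Icc 1 R, f ρ = if l + 2 ≤ m ∧ m ≤ 2 * R + l ∧ 2 ∣ m - l then f ((m - l) / 2) else 0 := by
  classical
  have hf : ∀ ρ ∈ Icc 1 R, f ρ = if 2 * ρ + l = m then f ρ else 0 := by
    intro ρ hρ
    rw [Finset.mem_Icc] at hρ
    by_cases hm : 2 * ρ + l = m
    · rw [if_pos hm]
    · rw [if_neg hm, h ρ hρ.1 hρ.2 hm]
  rw [Finset.sum_congr rfl hf, Finset.sum_ite, Finset.sum_const_zero, add_zero]
  by_cases hin : l + 2 ≤ m ∧ m ≤ 2 * R + l ∧ 2 ∣ m - l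
  · rw [if_pos hin]
    have hfilter : (Icc 1 R).filter (fun ρ => 2 * ρ + l = m) = {(m - l) / 2} := by
      ext ρ
      simp only [Finset.mem_filter, Finset.mem_Icc, Finset.mem_singleton]
      obtain ⟨h1, h2, ⟨k, hk⟩⟩ := hin
      omega
    rw [hfilter, Finset.sum_singleton]
  · rw [if_neg hin]
    have hfilter : (Icc 1 R).filter (fun ρ => 2 * ρ + l = m) = ∅ := by
      ext ρ
      simp only [Finset.mem_filter, Finset.mem_Icc, Finset.notMem_empty, iff_false, not_and]
      intro h1 h2
      exact hin ⟨by omega, by omega, ⟨ρ, by omega⟩⟩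
    rw [hfilter, Finset.sum_empty]

/-- **THE FOOT LINE OF A TOWER**: the rest double sum of a tower whose rest value is `κ ρ s` on the foot depth `2ρ + l = c` under a side condition `T s`, and `0`
elsewhere (the shape of ★ `restValue_G1_of_rows`), collapses to the single line `ρ⋆ = (c − l)∕2` when it is in range. [cite: Kottwitz1986BaseChangeUnits, §1 pp. 240–241] -/
theorem sum_sum_ite_dirac_rho (R l c : ℕ) (S : ℕ → ℕ) (Q : ℕ → ℕ → Prop) [∀ ρ, DecidablePred (Q ρ)]
    (T : ℕ → Prop) [DecidablePred T] (κ : ℕ → ℕ → ℚ) :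
    ∑ ρ ∈ Icc 1 R, ∑ s ∈ Icc 1 (S ρ), (if Q ρ s then (if 2 * ρ + l = c ∧ T s then κ ρ s else 0) else 0) =
      if l + 2 ≤ c ∧ c ≤ 2 * R + l ∧ 2 ∣ c - l then ∑ s ∈ Icc 1 (S ((c - l) / 2)), (if Q ((c - l) / 2) s ∧ T s then κ ((c - l) / 2) s else 0) else 0 := by
  classical
  rw [sum_Icc_eq_ite_of_vanish_off R l c (fun ρ => ∑ s ∈ Icc 1 (S ρ), (if Q ρ s then (if 2 * ρ + l = c ∧ T s then κ ρ s else 0) else 0))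
    (fun ρ _ _ hne => Finset.sum_eq_zero fun s _ => by
      by_cases hQ : Q ρ s
      · rw [if_pos hQ, if_neg (fun h => hne h.1)]
      · rw [if_neg hQ])]
  split_ifs with hin
  · refine Finset.sum_congr rfl fun s _ => ?_
    have hρ : 2 * ((c - l) / 2) + l = c := by obtain ⟨h1, -, ⟨k, hk⟩⟩ := hin; omega
    by_cases hQ : Q ((c - l) / 2) s <;> by_cases hT : T s
    · rw [if_pos hQ, if_pos ⟨hρ, hT⟩, if_pos ⟨hQ, hT⟩]
    · rw [if_pos hQ, if_neg (fun h => hT h.2), if_neg (fun h => hT h.2)]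
    · rw [if_neg hQ, if_neg (fun h => hQ h.1)]
    · rw [if_neg hQ, if_neg (fun h => hQ h.1)]
  · rfl

/-! ## ED. 2 (append-only) — the whole rest side of `harith` collapsed: one hanging point + three foot lines -/

/-- **THE REST SIDE OF `harith`, COLLAPSED** (ED. 2): with the hanging row `VH` vanishing off `2ρ + ℓ₀ = mH` and the three tower dispatchers in the shape
`VG k ρ s = if 2ρ + ℓ₀ = c_k ∧ T_k s then κ_k ρ s else 0` (★ `restValue_G1_of_rows`: `c₀ = n₂`, `T₀ s ↔ n₁ ≠ n₂ + s`; ★ `restValue_G2_of_rows`: `c₁ = n₁`, `T₁ s ↔ n₂ ≠ n₁ + s`;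
tower 3 analogous), the left-hand side of the socket's `harith` (★ `sum_box_restShape_eq_of_rows`, letters VERBATIM) equals ONE hanging value plus THREE foot-line sums — so `harith`
is reduced to the three s-line totals (R6's closed form) and the hanging value (R8) against `restTarget`. [cite: Kottwitz1986BaseChangeUnits, §1 pp. 240–241] -/
theorem rest_sum_eq_hanging_add_lines (B d n₁ n₂ n₃ mH c₀ c₁ c₂ : ℕ) (VH : ℕ → ℚ) (VG : Fin 3 → ℕ → ℕ → ℚ) (κ₀ κ₁ κ₂ : ℕ → ℕ → ℚ)
    (T₀ T₁ T₂ : ℕ → Prop) [DecidablePred T₀] [DecidablePred T₁] [DecidablePred T₂]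
    (hVH : ∀ ρ, 1 ≤ ρ → ρ ≤ B / 2 → 2 * ρ + d % 2 ≠ mH → VH ρ = 0)
    (hVG0 : ∀ ρ s, VG 0 ρ s = if 2 * ρ + d % 2 = c₀ ∧ T₀ s then κ₀ ρ s else 0)
    (hVG1 : ∀ ρ s, VG 1 ρ s = if 2 * ρ + d % 2 = c₁ ∧ T₁ s then κ₁ ρ s else 0)
    (hVG2 : ∀ ρ s, VG 2 ρ s = if 2 * ρ + d % 2 = c₂ ∧ T₂ s then κ₂ ρ s else 0) :
    ∑ ρ ∈ Icc 1 (B / 2), VH ρ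
      + ∑ ρ ∈ Icc 1 (B / 2), ∑ s ∈ Icc 1 (B - 2 * ρ),
          ((if 2 ∣ s ∧ ¬ (2 * ρ + s + d % 2 = n₁ ∧ 2 * ρ + 2 + d % 2 ≤ min n₂ n₃) then VG 0 ρ s else 0)
          + (if 2 ∣ s ∧ ¬ (2 * ρ + s + d % 2 = n₂ ∧ 2 * ρ + 2 + d % 2 ≤ min n₁ n₃) then VG 1 ρ s else 0)
          + (if 2 ∣ s ∧ ¬ (2 * ρ + s + d % 2 = n₃ ∧ 2 * ρ + 2 + d % 2 ≤ min n₁ n₂) then VG 2 ρ s else 0)) =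
      (if d % 2 + 2 ≤ mH ∧ mH ≤ 2 * (B / 2) + d % 2 ∧ 2 ∣ mH - d % 2 then VH ((mH - d % 2) / 2) else 0)
      + (if d % 2 + 2 ≤ c₀ ∧ c₀ ≤ 2 * (B / 2) + d % 2 ∧ 2 ∣ c₀ - d % 2 then
          ∑ s ∈ Icc 1 (B - 2 * ((c₀ - d % 2) / 2)),
            (if (2 ∣ s ∧ ¬ (2 * ((c₀ - d % 2) / 2) + s + d % 2 = n₁ ∧ 2 * ((c₀ - d % 2) / 2) + 2 + d % 2 ≤ min n₂ n₃)) ∧ T₀ s then κ₀ ((c₀ - d % 2) / 2) s else 0)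
         else 0)
      + (if d % 2 + 2 ≤ c₁ ∧ c₁ ≤ 2 * (B / 2) + d % 2 ∧ 2 ∣ c₁ - d % 2 then
          ∑ s ∈ Icc 1 (B - 2 * ((c₁ - d % 2) / 2)),
            (if (2 ∣ s ∧ ¬ (2 * ((c₁ - d % 2) / 2) + s + d % 2 = n₂ ∧ 2 * ((c₁ - d % 2) / 2) + 2 + d % 2 ≤ min n₁ n₃)) ∧ T₁ s then κ₁ ((c₁ - d % 2) / 2) s else 0)
         else 0)
      + (if d % 2 + 2 ≤ c₂ ∧ c₂ ≤ 2 * (B / 2) + d % 2 ∧ 2 ∣ c₂ - d % 2 then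
          ∑ s ∈ Icc 1 (B - 2 * ((c₂ - d % 2) / 2)),
            (if (2 ∣ s ∧ ¬ (2 * ((c₂ - d % 2) / 2) + s + d % 2 = n₃ ∧ 2 * ((c₂ - d % 2) / 2) + 2 + d % 2 ≤ min n₁ n₂)) ∧ T₂ s then κ₂ ((c₂ - d % 2) / 2) s else 0)
         else 0) := by
  classical
  rw [sum_Icc_eq_ite_of_vanish_off (B / 2) (d % 2) mH VH hVH]
  simp only [Finset.sum_add_distrib, hVG0, hVG1, hVG2]
  rw [sum_sum_ite_dirac_rho (B / 2) (d % 2) c₀ (fun ρ => B - 2 * ρ) (fun ρ s => 2 ∣ s ∧ ¬ (2 * ρ + s + d % 2 = n₁ ∧ 2 * ρ + 2 + d % 2 ≤ min n₂ n₃)) T₀ κ₀,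
    sum_sum_ite_dirac_rho (B / 2) (d % 2) c₁ (fun ρ => B - 2 * ρ) (fun ρ s => 2 ∣ s ∧ ¬ (2 * ρ + s + d % 2 = n₂ ∧ 2 * ρ + 2 + d % 2 ≤ min n₁ n₃)) T₁ κ₁,
    sum_sum_ite_dirac_rho (B / 2) (d % 2) c₂ (fun ρ => B - 2 * ρ) (fun ρ s => 2 ∣ s ∧ ¬ (2 * ρ + s + d % 2 = n₃ ∧ 2 * ρ + 2 + d % 2 ≤ min n₁ n₂)) T₂ κ₂]
  ring

end Summit.HodgeConjecture.HodgeConjecture.Cruxes.H413.F0P3cDyRamOddLabelledRestLines
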